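import Summits.RiemannHypothesis.RiemannHypothesis.Theorems.PfPersistenceM2LeakCriteria
import HarnessLib

/-!
# M2 upper half (6/7): the assembly (H-LEAK-L1) ⇒ `ConnesLawUpperWitnessWith (2p + 1 + δ)`

pub-rhpf cell (M2 seat, generation 3) — part 6 of 7 of the M2 UPPER-HALF packet.  HONEST FRAMING:
long-odds MECHANISM SEARCH; no RH claims.  Everything in this file is PROVED (kernel-checked, RH-free) or an
explicitly named `def … : Prop` taken as an argument; nothing here implies or assumes RH.  The packet's
headline and full ledger are in `PfPersistenceM2UpperLeak.lean` (part 7):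
`ProlateLeakL1 A p Λ` (ONE RH-free prolate leak bound, exponent `p`) + two named literature facts
⇒ `ConnesLawUpperWitnessWith (2p + 1 + δ)` ⇒ `ConnesLawUpperWith (2p + 1 + δ)` ⇒ `ConnesLawUpper`.

This part (PROVED): `exists_rayleigh_witness_of_leak` — from `ProlateLeakL1 A p Λ`, the mollifier decay
`MollifierMellinDecay` (proved in part 4) and the norm floor `LeakWitnessNormFloor Λ' c` (proved in part 7
from Fact 6.4), for every `0 < δ ≤ 1` and eventually in `a`: a window test `k` with
`Re W(k) ≤ C μ^{2p+1+δ} e^{-4πμ} ‖k‖₂²`; hence `connesLawUpperWith_of_leak` (energy form) and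
`connesLawUpperWitnessWith_of_leak` (normalised witness form).  Recipe at window `a`: `μ = e^{2a}`,
`n = ⌈μ⌉₊`, mollifier radius `1/(n+1)`, `N = ⌊μ e^{-2/(n+1)}⌋₊ ≥ μ − 3`, `λ = √N`, witness `k = k₀ ⋆ φ_n`
(part 3), weights `w_j = E₀ log²(j+5) min(1, K'/(j+1))²` fed to the window criterion (part 5), the zeros
placed by `norm_weilMellin_moll_le_min` and part 2, the partial sums by `windowSum_le` (part 4).
-/

noncomputable section

set_option linter.dupNamespace false  -- the mandated namespace repeats `RiemannHypothesis`

open Complex Filter Set Topology Metric MeasureTheory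
open Literature.NumberTheory.LFunctions
open scoped ComplexConjugate Convolution

namespace Summit.RiemannHypothesis.RiemannHypothesis.Theorems.PfPersistenceM2Leak

/-! ## §I (continued) The assembly proper -/

section Assembly

open WeilContinuous

/-- **THE REDUCTION (PROVED), Rayleigh form: the prolate leak bound gives, eventually in `a`, a window
test function with `Re W(k) ≤ C μ^{2p+1+δ} e^{-4πμ} ‖k‖₂²`.**  Inputs: uniqueness of the prolate functions
(named Slepian–Pollak fact), the leak hypothesis (H-LEAK-L1) with exponent `p`, the mollifier decay and the
norm floor (both RH-free, routine, typed above and proved in this packet).  Witness at window `a`: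
`k = k₀ ⋆ φ_n`, `n = ⌈μ⌉₊`, `N = λ² = ⌊μ e^{−2/(n+1)}⌋₊ ≥ μ − 3`; zeros counted by `exists_windowCount`
(sharp), abscissae by `exists_div_log_le_re`, partial sums by `windowSum_le`. -/
theorem exists_rayleigh_witness_of_leak (hE : existsUnique_isProlateFunction) {A p Λ Λ' c : ℝ}
    (hA : 0 ≤ A) (hp : 0 ≤ p) (hL : ProlateLeakL1 A p Λ) (hD : MollifierMellinDecay)
    (hF : LeakWitnessNormFloor Λ' c) {δ : ℝ} (hδ : 0 < δ) (hδ1 : δ ≤ 1) :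
    ∃ C a₀ : ℝ, 0 ≤ C ∧ ∀ a : ℝ, a₀ ≤ a → ∃ k : ℝ → ℂ, IsWeilTest k ∧ tsupport k ⊆ Icc (-a) a ∧
      0 < ∫ t : ℝ, ‖k t‖ ^ 2 ∧ (weilQuadratic k).re ≤
        C * Real.exp (2 * a) ^ (2 * p + 1 + δ) * Real.exp (-(4 * Real.pi * Real.exp (2 * a))) *
          ∫ t : ℝ, ‖k t‖ ^ 2 := by
  obtain ⟨C_D', hCD0', hCD'⟩ := hD
  obtain ⟨C_D, hCDdef⟩ : ∃ C : ℝ, C = max C_D' 1 := ⟨_, rfl⟩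
  have hCD1 : 1 ≤ C_D := hCDdef ▸ le_max_right _ _
  have hCD0 : 0 < C_D := by linarith
  have hCD : ∀ (n : ℕ) (s : ℂ), ‖weilMellin (moll n) s‖ * ‖s - 1 / 2‖ ≤
      C_D * ((n : ℝ) + 1) * Real.exp (|s.re - 1 / 2| / ((n : ℝ) + 1)) := fun n s ↦
    (hCD' n s).trans (by rw [hCDdef]; gcongr; exact le_max_left _ _)
  obtain ⟨c₀, hc₀, hc⟩ := exists_div_log_le_re
  obtain ⟨C_W, hCW0, hCW⟩ := windowSum_le (ε := δ / 2) (by positivity) (by linarith)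
  obtain ⟨C_E, hCE0, hCE⟩ := exists_re_weilQuadratic_le_of_windowBound
  obtain ⟨hc_pos, hFloor⟩ := hF
  -- the uniform constant
  obtain ⟨D₀, hD₀⟩ : ∃ D : ℝ, D = (Real.exp 1 * A ^ 2 / c₀ ^ 2 * Real.exp (12 * Real.pi)) *
      (C_W * (12 * C_D) ^ (1 + δ / 2)) * ((2 / δ + 2) / c) := ⟨_, rfl⟩
  have hD₀0 : 0 ≤ D₀ := by rw [hD₀]; positivity
  -- the threshold
  obtain ⟨T₀, hT₀⟩ : ∃ T : ℝ, T = max (max Λ Λ') 1 := ⟨_, rfl⟩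
  have hT₀1 : 1 ≤ T₀ := hT₀ ▸ le_max_right _ _
  have hT₀Λ : Λ ≤ T₀ := hT₀ ▸ (le_max_left _ _).trans (le_max_left _ _)
  have hT₀Λ' : Λ' ≤ T₀ := hT₀ ▸ (le_max_right _ _).trans (le_max_left _ _)
  obtain ⟨a₀, ha₀⟩ : ∃ a₀ : ℝ, a₀ = Real.log (T₀ + 1) / 2 + 2 := ⟨_, rfl⟩
  refine ⟨C_E * D₀, a₀, mul_nonneg hCE0.le hD₀0, fun a ha0 ↦ ?_⟩
  have ha2 : (2 : ℝ) ≤ a := by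
    have h := Real.log_nonneg (show (1 : ℝ) ≤ T₀ + 1 by linarith)
    linarith
  -- the window parameters: `μ = e^{2a}`, `n = ⌈μ⌉₊`, `K = n + 1`, `η = 1/K`, `N = ⌊μ e^{-2η}⌋₊`
  obtain ⟨μ, hμ⟩ : ∃ μ : ℝ, μ = Real.exp (2 * a) := ⟨_, rfl⟩
  rw [← hμ]
  have hμ1 : 1 ≤ μ := hμ ▸ Real.one_le_exp (by linarith)
  have hμ0 : 0 < μ := by linarith
  have hμT : T₀ + 3 ≤ μ := by
    have h4 : (4 : ℝ) ≤ Real.exp 4 := by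
      have := Real.add_one_le_exp (4 : ℝ); linarith
    have h5 : Real.exp (2 * a₀) ≤ μ := hμ ▸ Real.exp_le_exp.2 (by linarith)
    have e : Real.exp (2 * a₀) = (T₀ + 1) * Real.exp 4 := by
      rw [ha₀, show 2 * (Real.log (T₀ + 1) / 2 + 2) = Real.log (T₀ + 1) + 4 by ring, Real.exp_add,
        Real.exp_log (by linarith)]
    have h6 : (T₀ + 1) * 4 ≤ (T₀ + 1) * Real.exp 4 := mul_le_mul_of_nonneg_left h4 (by linarith)
    linarith
  obtain ⟨n, hn⟩ : ∃ n : ℕ, n = ⌈μ⌉₊ := ⟨_, rfl⟩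
  have hKμ : μ ≤ (n : ℝ) + 1 := by
    have : μ ≤ (n : ℝ) := hn ▸ Nat.le_ceil μ
    linarith
  have hK3 : (n : ℝ) + 1 ≤ 3 * μ := by
    have : ((n : ℕ) : ℝ) < μ + 1 := hn ▸ Nat.ceil_lt_add_one hμ0.le
    linarith
  have hK1 : (1 : ℝ) ≤ (n : ℝ) + 1 := by linarith [n.cast_nonneg (α := ℝ)]
  have hK0 : (0 : ℝ) < (n : ℝ) + 1 := by linarith
  obtain ⟨η, hη⟩ : ∃ η : ℝ, η = 1 / ((n : ℝ) + 1) := ⟨_, rfl⟩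
  have hη0 : 0 < η := by rw [hη]; positivity
  have hη1 : η ≤ 1 := by rw [hη]; exact (div_le_one hK0).2 hK1
  have hμη : μ * η ≤ 1 := by rw [hη, mul_one_div]; exact (div_le_one hK0).2 hKμ
  obtain ⟨N, hNdef⟩ : ∃ N : ℕ, N = ⌊μ * Real.exp (-(2 * η))⌋₊ := ⟨_, rfl⟩
  have hNle : (N : ℝ) ≤ μ * Real.exp (-(2 * η)) := hNdef ▸ Nat.floor_le (by positivity)
  have hNμ : (N : ℝ) ≤ μ :=
    hNle.trans (mul_le_of_le_one_right hμ0.le (Real.exp_le_one_iff.2 (by linarith)))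
  have hNge : μ - 3 ≤ (N : ℝ) := by
    have h1 : μ * Real.exp (-(2 * η)) - 1 ≤ N := by
      have := Nat.lt_floor_add_one (μ * Real.exp (-(2 * η)))
      rw [← hNdef] at this; linarith
    have h2 : 1 - 2 * η ≤ Real.exp (-(2 * η)) := by
      have := Real.add_one_le_exp (-(2 * η)); linarith
    have h3 : μ * (1 - 2 * η) ≤ μ * Real.exp (-(2 * η)) := mul_le_mul_of_nonneg_left h2 hμ0.le
    nlinarith
  have hNT : T₀ ≤ (N : ℝ) := by linarith
  have hN1 : (1 : ℝ) ≤ N := hT₀1.trans hNT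
  have hN0 : (0 : ℝ) < N := by linarith
  have hNΛ : Λ ≤ (N : ℝ) := hT₀Λ.trans hNT
  have hNΛ' : Λ' ≤ (N : ℝ) := hT₀Λ'.trans hNT
  have hlam0 : 0 < Real.sqrt N := Real.sqrt_pos.2 hN0
  -- the prolate pair
  obtain ⟨f0, h0, -⟩ := hE (Real.sqrt N) hlam0 0 (by decide)
  obtain ⟨f4, h4, -⟩ := hE (Real.sqrt N) hlam0 4 (by decide)
  -- the witness
  obtain ⟨k, hkdef⟩ : ∃ k : ℝ → ℂ, k = leakWitness (Real.sqrt N) f0 f4 n := ⟨_, rfl⟩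
  have hk : IsWeilTest k := hkdef ▸ isWeilTest_leakWitness hE h0 h4 n
  have hlog : Real.log (Real.sqrt N) + 1 / ((n : ℝ) + 1) ≤ a := by
    have hl : Real.log (Real.sqrt N) = Real.log N / 2 := Real.log_sqrt hN0.le
    have hlogμ' : Real.log μ = 2 * a := by rw [hμ, Real.log_exp]
    have hlN : Real.log N ≤ 2 * a - 2 * η := by
      have := Real.log_le_log hN0 hNle
      rw [Real.log_mul hμ0.ne' (Real.exp_pos _).ne', hlogμ', Real.log_exp] at this
      linarith
    rw [hl, ← hη]; linarith
  have hsupp : tsupport k ⊆ Icc (-a) a :=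
    hkdef ▸ (tsupport_leakWitness_subset hlam0 f0 f4 n).trans (Icc_subset_Icc (by linarith) hlog)
  -- the norm floor
  have hfloor : c ≤ (Real.log N + 2) * ∫ t : ℝ, ‖k t‖ ^ 2 := hkdef ▸ hFloor N hNΛ' f0 f4 h0 h4 n
  have hlogN0 : 0 ≤ Real.log N := Real.log_nonneg hN1
  have hpos : 0 < ∫ t : ℝ, ‖k t‖ ^ 2 := by
    by_contra hle
    push Not at hle
    have : (Real.log N + 2) * ∫ t : ℝ, ‖k t‖ ^ 2 ≤ 0 :=
      mul_nonpos_iff.2 (Or.inl ⟨by linarith, hle⟩)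
    linarith
  -- the weight
  obtain ⟨L₀, hL₀⟩ : ∃ L : ℝ, L = A * (N : ℝ) ^ p * Real.exp (-(2 * Real.pi * N)) := ⟨_, rfl⟩
  have hL₀0 : 0 ≤ L₀ := by rw [hL₀]; positivity
  obtain ⟨K', hK'⟩ : ∃ K' : ℝ, K' = 4 * C_D * ((n : ℝ) + 1) := ⟨_, rfl⟩
  have hK'1 : 1 ≤ K' := by
    have := one_le_mul_of_one_le_of_one_le hCD1 hK1
    rw [hK']; linarith
  have hK'0 : 0 < K' := by linarith
  obtain ⟨E₀, hE₀⟩ : ∃ E : ℝ, E = Real.exp 1 * (L₀ / c₀) ^ 2 := ⟨_, rfl⟩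
  have hE₀0 : 0 ≤ E₀ := by rw [hE₀]; positivity
  obtain ⟨w, hw⟩ : ∃ w : ℕ → ℝ, w = fun j : ℕ ↦
      E₀ * (Real.log ((j : ℝ) + 5) ^ 2 * (min 1 (K' / ((j : ℝ) + 1))) ^ 2) := ⟨_, rfl⟩
  have hwj : ∀ j : ℕ, w j = E₀ * (Real.log ((j : ℝ) + 5) ^ 2 * (min 1 (K' / ((j : ℝ) + 1))) ^ 2) :=
    fun j ↦ by rw [hw]
  have hw0 : ∀ j, 0 ≤ w j := fun j ↦ by rw [hwj]; positivity
  have he : Real.exp (1 / 2) ^ 2 = Real.exp 1 := by rw [sq, ← Real.exp_add]; norm_num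
  -- the bound at the zeros
  have hzero : ∀ ρ ∈ ZetaZeros.riemannZetaNontrivialZeros, ‖weilMellin k ρ‖ ^ 2 ≤ w (windowIndex ρ) := by
    intro ρ hρ
    have hre := ZetaZeros.riemannZetaNontrivialZeros.re_pos hρ
    have h1 := norm_weilMellin_leakWitness_le hE hL hNΛ h0 h4 n hρ
    rw [← hL₀, ← hkdef] at h1
    have h2 := norm_weilMellin_moll_le_min hCD1 hCD n hρ
    rw [← hK'] at h2
    have hj0 : (0 : ℝ) ≤ (windowIndex ρ : ℝ) := Nat.cast_nonneg _
    have hjle : |ρ.im| - 1 / 2 ≤ (windowIndex ρ : ℝ) := le_windowIndex ρ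
    have him0 : 0 ≤ |ρ.im| := abs_nonneg _
    have h3 : L₀ / ρ.re ≤ L₀ / c₀ * Real.log ((windowIndex ρ : ℝ) + 5) := by
      have hcρ := (hc ρ hρ).1
      have hlog4 : 0 < Real.log (|ρ.im| + 4) := Real.log_pos (by linarith)
      have hlogle : Real.log (|ρ.im| + 4) ≤ Real.log ((windowIndex ρ : ℝ) + 5) :=
        Real.log_le_log (by linarith) (by linarith)
      calc L₀ / ρ.re ≤ L₀ / (c₀ / Real.log (|ρ.im| + 4)) :=
            div_le_div_of_nonneg_left hL₀0 (by positivity) hcρ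
        _ = L₀ / c₀ * Real.log (|ρ.im| + 4) := by field_simp
        _ ≤ L₀ / c₀ * Real.log ((windowIndex ρ : ℝ) + 5) :=
            mul_le_mul_of_nonneg_left hlogle (by positivity)
    have h4 : ‖weilMellin k ρ‖ ≤ (L₀ / c₀ * Real.log ((windowIndex ρ : ℝ) + 5)) *
        (Real.exp (1 / 2) * min 1 (K' / ((windowIndex ρ : ℝ) + 1))) :=
      h1.trans (mul_le_mul h3 h2 (norm_nonneg _)
        (mul_nonneg (div_nonneg hL₀0 hc₀.le) (Real.log_nonneg (by linarith))))
    have h5 := pow_le_pow_left₀ (norm_nonneg _) h4 2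
    refine h5.trans (le_of_eq ?_)
    rw [hwj, hE₀, ← he]; ring
  -- the partial sums
  have hNp : ((N : ℝ) ^ p) ^ 2 ≤ μ ^ (2 * p) := by
    calc ((N : ℝ) ^ p) ^ 2 ≤ (μ ^ p) ^ 2 :=
          pow_le_pow_left₀ (Real.rpow_nonneg hN0.le _) (Real.rpow_le_rpow hN0.le hNμ hp) 2
      _ = μ ^ (2 * p) := by rw [show (2 : ℝ) * p = p + p by ring, Real.rpow_add hμ0, sq]
  have hexpN : Real.exp (-(2 * Real.pi * N)) ^ 2 ≤
      Real.exp (12 * Real.pi) * Real.exp (-(4 * Real.pi * μ)) := by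
    rw [sq, ← Real.exp_add, ← Real.exp_add]
    refine Real.exp_le_exp.2 ?_
    have : Real.pi * (μ - N) ≤ Real.pi * 3 := mul_le_mul_of_nonneg_left (by linarith) Real.pi_pos.le
    linarith
  have hE₀le : E₀ ≤ Real.exp 1 * A ^ 2 / c₀ ^ 2 * Real.exp (12 * Real.pi) *
      (μ ^ (2 * p) * Real.exp (-(4 * Real.pi * μ))) := by
    have e1 : E₀ = Real.exp 1 * A ^ 2 / c₀ ^ 2 *
        (((N : ℝ) ^ p) ^ 2 * Real.exp (-(2 * Real.pi * N)) ^ 2) := by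
      rw [hE₀, hL₀]; ring
    rw [e1]
    have : ((N : ℝ) ^ p) ^ 2 * Real.exp (-(2 * Real.pi * N)) ^ 2 ≤
        μ ^ (2 * p) * (Real.exp (12 * Real.pi) * Real.exp (-(4 * Real.pi * μ))) :=
      mul_le_mul hNp hexpN (sq_nonneg _) (Real.rpow_nonneg hμ0.le _)
    calc Real.exp 1 * A ^ 2 / c₀ ^ 2 * (((N : ℝ) ^ p) ^ 2 * Real.exp (-(2 * Real.pi * N)) ^ 2)
        ≤ Real.exp 1 * A ^ 2 / c₀ ^ 2 *
            (μ ^ (2 * p) * (Real.exp (12 * Real.pi) * Real.exp (-(4 * Real.pi * μ)))) :=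
          mul_le_mul_of_nonneg_left this (by positivity)
      _ = _ := by ring
  have hK'le : K' ^ (1 + δ / 2) ≤ (12 * C_D) ^ (1 + δ / 2) * μ ^ (1 + δ / 2) := by
    have hK'μ : K' ≤ 12 * C_D * μ := by
      have := mul_le_mul_of_nonneg_left hK3 (show 0 ≤ 4 * C_D by positivity)
      rw [hK']; linarith
    calc K' ^ (1 + δ / 2) ≤ (12 * C_D * μ) ^ (1 + δ / 2) :=
          Real.rpow_le_rpow hK'0.le hK'μ (by positivity)
      _ = (12 * C_D) ^ (1 + δ / 2) * μ ^ (1 + δ / 2) := Real.mul_rpow (by positivity) hμ0.le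
  have hone : 1 ≤ (2 / δ + 2) / c * μ ^ (δ / 2) * ∫ t : ℝ, ‖k t‖ ^ 2 := by
    have hμδ : 1 ≤ μ ^ (δ / 2) := Real.one_le_rpow hμ1 (by positivity)
    have hlogμ : Real.log μ ≤ 2 / δ * μ ^ (δ / 2) := by
      have := Real.log_le_rpow_div hμ0.le (show 0 < δ / 2 by positivity)
      calc Real.log μ ≤ μ ^ (δ / 2) / (δ / 2) := this
        _ = 2 / δ * μ ^ (δ / 2) := by field_simp
    have hlogNμ : Real.log N ≤ Real.log μ := Real.log_le_log hN0 hNμ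
    have hsplit : (2 / δ + 2) * μ ^ (δ / 2) = 2 / δ * μ ^ (δ / 2) + 2 * μ ^ (δ / 2) := by ring
    have h1 : Real.log N + 2 ≤ (2 / δ + 2) * μ ^ (δ / 2) := by rw [hsplit]; linarith
    have h2 : c ≤ (2 / δ + 2) * μ ^ (δ / 2) * ∫ t : ℝ, ‖k t‖ ^ 2 :=
      hfloor.trans (mul_le_mul_of_nonneg_right h1 hpos.le)
    rw [div_mul_eq_mul_div, div_mul_eq_mul_div, le_div_iff₀ hc_pos, one_mul]
    exact h2
  have hμpow : μ ^ (2 * p) * μ ^ (1 + δ / 2) * μ ^ (δ / 2) = μ ^ (2 * p + 1 + δ) := by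
    rw [← Real.rpow_add hμ0, ← Real.rpow_add hμ0]; ring_nf
  have hsumle : ∀ M : ℕ, ∑ j ∈ Finset.range M, Real.log ((j : ℝ) + 2) * w j ≤
      D₀ * μ ^ (2 * p + 1 + δ) * Real.exp (-(4 * Real.pi * μ)) * ∫ t : ℝ, ‖k t‖ ^ 2 := by
    intro M
    have hS := hCW K' hK'1 M
    have e1 : ∑ j ∈ Finset.range M, Real.log ((j : ℝ) + 2) * w j =
        E₀ * ∑ j ∈ Finset.range M, Real.log ((j : ℝ) + 2) *
          (Real.log ((j : ℝ) + 5) ^ 2 * (min 1 (K' / ((j : ℝ) + 1))) ^ 2) := by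
      rw [Finset.mul_sum]
      exact Finset.sum_congr rfl fun j _ ↦ by rw [hwj]; ring
    rw [e1]
    have hS0 : 0 ≤ C_W * K' ^ (1 + δ / 2) := by positivity
    calc E₀ * ∑ j ∈ Finset.range M, Real.log ((j : ℝ) + 2) *
            (Real.log ((j : ℝ) + 5) ^ 2 * (min 1 (K' / ((j : ℝ) + 1))) ^ 2)
        ≤ E₀ * (C_W * K' ^ (1 + δ / 2)) := mul_le_mul_of_nonneg_left hS hE₀0
      _ ≤ E₀ * (C_W * K' ^ (1 + δ / 2)) * ((2 / δ + 2) / c * μ ^ (δ / 2) * ∫ t : ℝ, ‖k t‖ ^ 2) :=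
          le_mul_of_one_le_right (mul_nonneg hE₀0 hS0) hone
      _ ≤ (Real.exp 1 * A ^ 2 / c₀ ^ 2 * Real.exp (12 * Real.pi) *
              (μ ^ (2 * p) * Real.exp (-(4 * Real.pi * μ)))) *
            (C_W * ((12 * C_D) ^ (1 + δ / 2) * μ ^ (1 + δ / 2))) *
            ((2 / δ + 2) / c * μ ^ (δ / 2) * ∫ t : ℝ, ‖k t‖ ^ 2) := by
          refine mul_le_mul_of_nonneg_right (mul_le_mul hE₀le
            (mul_le_mul_of_nonneg_left hK'le hCW0.le) hS0 (by positivity)) (by positivity)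
      _ = D₀ * (μ ^ (2 * p) * μ ^ (1 + δ / 2) * μ ^ (δ / 2)) * Real.exp (-(4 * Real.pi * μ)) *
            ∫ t : ℝ, ‖k t‖ ^ 2 := by rw [hD₀]; ring
      _ = _ := by rw [hμpow]
  -- conclude
  refine ⟨k, hk, hsupp, hpos, ?_⟩
  have hfin := hCE (D₀ * μ ^ (2 * p + 1 + δ) * Real.exp (-(4 * Real.pi * μ))) k w hk hw0 hzero hsumle
  calc (weilQuadratic k).re
      ≤ C_E * (D₀ * μ ^ (2 * p + 1 + δ) * Real.exp (-(4 * Real.pi * μ))) * ∫ t : ℝ, ‖k t‖ ^ 2 := hfin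
    _ = C_E * D₀ * μ ^ (2 * p + 1 + δ) * Real.exp (-(4 * Real.pi * μ)) * ∫ t : ℝ, ‖k t‖ ^ 2 := by ring

/-- **THE ASSEMBLY, energy form.**  (H-LEAK-L1) + the mollifier decay + the norm floor ⇒
`ConnesLawUpperWith (2p + 1 + δ)` for every `0 < δ ≤ 1` (`ε(a) ≤ Re W(k)/‖k‖₂²`, `weilGroundEnergy_le_div`,
and the small-window fallback `connesLawUpperWith_of_eventually`). -/
theorem connesLawUpperWith_of_leak (hE : existsUnique_isProlateFunction) {A p Λ Λ' c : ℝ}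
    (hA : 0 ≤ A) (hp : 0 ≤ p) (hL : ProlateLeakL1 A p Λ) (hD : MollifierMellinDecay)
    (hF : LeakWitnessNormFloor Λ' c) {δ : ℝ} (hδ : 0 < δ) (hδ1 : δ ≤ 1) :
    ConnesLawUpperWith (2 * p + 1 + δ) := by
  obtain ⟨C, a₀, -, h⟩ := exists_rayleigh_witness_of_leak hE hA hp hL hD hF hδ hδ1
  refine connesLawUpperWith_of_eventually (B := 2 * p + 1 + δ) (by positivity) (a₀ := a₀) (C := C)
    fun a ha0 _ ↦ ?_
  obtain ⟨k, hk, hs, hpos, hW⟩ := h a ha0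
  refine (weilGroundEnergy_le_div hk hs hpos).trans ?_
  rw [div_le_iff₀ hpos]
  exact hW

/-- **THE ASSEMBLY, witness form** (`ConnesLawUpperWitnessWith`, the shape consumed by
`PfPersistenceM2Laws.m2_asymptotic_of_three_laws`). -/
theorem connesLawUpperWitnessWith_of_leak (hE : existsUnique_isProlateFunction) {A p Λ Λ' c : ℝ}
    (hA : 0 ≤ A) (hp : 0 ≤ p) (hL : ProlateLeakL1 A p Λ) (hD : MollifierMellinDecay)
    (hF : LeakWitnessNormFloor Λ' c) {δ : ℝ} (hδ : 0 < δ) (hδ1 : δ ≤ 1) :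
    ConnesLawUpperWitnessWith (2 * p + 1 + δ) := by
  obtain ⟨C, a₀, -, h⟩ := exists_rayleigh_witness_of_leak hE hA hp hL hD hF hδ hδ1
  exact connesLawUpperWitnessWith_of_rayleigh h

end Assembly

end Summit.RiemannHypothesis.RiemannHypothesis.Theorems.PfPersistenceM2Leak
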